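import Summits.QuantumAdvantage.QuantumAdvantage.Theorems.MobiusLadderLiouvilleOrthogonalTC0StubWindowAverage
import Summits.QuantumAdvantage.QuantumAdvantage.Theorems.MobiusLadderLiouvilleOrthogonalTC0StubAlignedBlocks
import Summits.QuantumAdvantage.QuantumAdvantage.Theorems.MobiusLadderLiouvilleOrthogonalTC0StubTopDigits
import Literature.Computability.Complexity.Circuit
import HarnessLib

/-!
# Crux `MobiusLadder.LiouvilleOrthogonalTC0` (stmt-QuantumAdvantage-1393), line `Sketch`, skeleton v9:
# the TOP-DIGITS RUNG, packaged (unconditional)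

The Liouville function is asymptotically orthogonal to EVERY function of the binary digits that
ignores the lowest `ψ(n)` of them, as soon as `ψ(n) → ∞` — however slowly, and whatever the size,
depth or gate basis of a circuit computing the function. Assembled from the three landed v9 stubs
`stub_windowAverage` (p137878), `stub_alignedBlocks` (p138501, from the tree's PROVED
Matomäki–Radziwiłł theorem `matomaki_radziwill_holds` and the prime number theorem for `λ`) and
`stub_topDigits` (p138891):

* `liouville_orthogonal_topDigits` — for non-decreasing unbounded `ψ`: `∀ ε > 0`, eventually in `n`,
  for ALL `G : ℕ → Bool`, `|Σ_{N<2ⁿ} λ(N) sgn G(⌊N/2^{ψ n}⌋)| ≤ ε 2ⁿ`;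
* `liouville_orthogonal_topDigits_of_tendsto` — the same for every `ψ` with `ψ(n) → ∞`
  (monotonisation `ψ*(n) = min_{m ≥ n} ψ(m)`: a function of `⌊N/2^{ψ n}⌋` is a function of
  `⌊N/2^{ψ* n}⌋`);
* `liouville_orthogonal_topDigits_real` — the `ℓ¹`/real-valued form: for every `1`-bounded
  `G : ℕ → ℝ` (sign trick: the worst `G` is the sign of the block sums, a Boolean function);
* `liouville_orthogonal_circuit_topDigits` — circuit language: every circuit on the `n` digits (any
  gates, depth, size) whose value does not depend on the inputs `x_i`, `i < ψ(n)`.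

Sharpness remark (not formalised): `ψ → ∞` cannot be dropped — for `ψ ≡ c` the Boolean function
`G(u) = [Σ_{r<2^c} λ(u2^c + r) < 0]` has correlation `2^{-n} Σ_u |Σ_{r<2^c} λ(u 2^c + r)|`, which is
not `o(1)` (blocks of bounded length).
-/

set_option linter.dupNamespace false -- D-0017: single-problem summit ⇒ `QuantumAdvantage.QuantumAdvantage` by design

noncomputable section

namespace Summit.QuantumAdvantage.QuantumAdvantage.Theorems.LiouvilleOrthogonalTC0

open Filter Finset
open Literature.Computability.Complexity
open Literature.Probability.RandomGraphs.LowDegree (sgn)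

/-- **The top-digits rung (unconditional).** For every non-decreasing unbounded `ψ : ℕ → ℕ` and
every `ε > 0`, for all sufficiently large `n` and ALL `G : ℕ → Bool`,
`|Σ_{N<2ⁿ} λ(N) sgn G(⌊N/2^{ψ n}⌋)| ≤ ε 2ⁿ` (Matomäki–Radziwiłł on aligned dyadic blocks). -/
theorem liouville_orthogonal_topDigits (ψ : ℕ → ℕ) (hψ : Monotone ψ) (hψ' : Tendsto ψ atTop atTop) :
    ∀ ε : ℝ, 0 < ε → ∀ᶠ n : ℕ in atTop, ∀ G : ℕ → Bool,
      |∑ N ∈ Finset.range (2 ^ n), ((ArithmeticFunction.liouville N : ℤ) : ℝ) *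
          sgn (G (N / 2 ^ ψ n))| ≤ ε * (2 : ℝ) ^ n :=
  stub_topDigits (stub_alignedBlocks stub_windowAverage) ψ hψ hψ'

/-- Monotonisation of an unbounded sequence: `ψ*(n) = min {ψ m : m ≥ n}` is non-decreasing,
unbounded, and `ψ* ≤ ψ`. -/
theorem exists_monotone_minorant (ψ : ℕ → ℕ) (hψ' : Tendsto ψ atTop atTop) :
    ∃ ψ' : ℕ → ℕ, Monotone ψ' ∧ Tendsto ψ' atTop atTop ∧ ∀ n, ψ' n ≤ ψ n := by
  classical
  refine ⟨fun n => sInf (ψ '' Set.Ici n), ?_, ?_, ?_⟩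
  · intro n m hnm
    have hne : (ψ '' Set.Ici m).Nonempty := ⟨ψ m, m, Set.mem_Ici.2 le_rfl, rfl⟩
    obtain ⟨k, hk, hkψ⟩ := Nat.sInf_mem hne
    calc sInf (ψ '' Set.Ici n) ≤ ψ k := Nat.sInf_le ⟨k, Set.mem_Ici.2 (le_trans hnm hk), rfl⟩
      _ = sInf (ψ '' Set.Ici m) := hkψ
  · refine tendsto_atTop_atTop.2 fun b => ?_
    obtain ⟨n₀, hn₀⟩ := (tendsto_atTop_atTop.1 hψ') b
    refine ⟨n₀, fun n hn => ?_⟩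
    have hne : (ψ '' Set.Ici n).Nonempty := ⟨ψ n, n, Set.mem_Ici.2 le_rfl, rfl⟩
    obtain ⟨k, hk, hkψ⟩ := Nat.sInf_mem hne
    calc b ≤ ψ k := hn₀ k (le_trans hn hk)
      _ = sInf (ψ '' Set.Ici n) := hkψ
  · exact fun n => Nat.sInf_le ⟨n, Set.mem_Ici.2 le_rfl, rfl⟩

/-- **The top-digits rung for every unbounded `ψ`** (not necessarily monotone). -/
theorem liouville_orthogonal_topDigits_of_tendsto (ψ : ℕ → ℕ) (hψ' : Tendsto ψ atTop atTop) :
    ∀ ε : ℝ, 0 < ε → ∀ᶠ n : ℕ in atTop, ∀ G : ℕ → Bool,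
      |∑ N ∈ Finset.range (2 ^ n), ((ArithmeticFunction.liouville N : ℤ) : ℝ) *
          sgn (G (N / 2 ^ ψ n))| ≤ ε * (2 : ℝ) ^ n := by
  obtain ⟨ψ', hmono, htend, hle⟩ := exists_monotone_minorant ψ hψ'
  intro ε hε
  filter_upwards [liouville_orthogonal_topDigits ψ' hmono htend ε hε] with n hn G
  have key : ∀ N : ℕ, N / 2 ^ ψ n = (N / 2 ^ ψ' n) / 2 ^ (ψ n - ψ' n) := by
    intro N
    rw [Nat.div_div_eq_div_mul, ← pow_add, Nat.add_sub_cancel' (hle n)]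
  simp only [key]
  exact hn (fun u => G (u / 2 ^ (ψ n - ψ' n)))

/-- Regrouping a sum by the fibres of `N ↦ ⌊N/2^T⌋` on `N < 2ⁿ`. -/
theorem sum_range_mul_comp_div (n T : ℕ) (a : ℕ → ℝ) (G : ℕ → ℝ) :
    ∑ N ∈ Finset.range (2 ^ n), a N * G (N / 2 ^ T) =
      ∑ u ∈ Finset.range (2 ^ n), G u *
        ∑ N ∈ (Finset.range (2 ^ n)).filter (fun N => N / 2 ^ T = u), a N := by
  have hmaps : ∀ N ∈ Finset.range (2 ^ n), N / 2 ^ T ∈ Finset.range (2 ^ n) := by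
    intro N hN
    rw [Finset.mem_range] at hN ⊢
    exact lt_of_le_of_lt (Nat.div_le_self _ _) hN
  rw [← Finset.sum_fiberwise_of_maps_to hmaps]
  refine Finset.sum_congr rfl fun u _ => ?_
  rw [Finset.mul_sum]
  refine Finset.sum_congr rfl fun N hN => ?_
  rw [Finset.mem_filter] at hN
  rw [hN.2, mul_comm]

/-- **The top-digits rung, real-valued form.** For unbounded `ψ` and `ε > 0`, eventually in `n`,
for every `G : ℕ → ℝ` with `|G| ≤ 1`, `|Σ_{N<2ⁿ} λ(N) G(⌊N/2^{ψ n}⌋)| ≤ ε 2ⁿ` — equivalently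
`Σ_u |Σ_{N<2ⁿ, ⌊N/2^{ψ n}⌋ = u} λ(N)| ≤ ε 2ⁿ` (take `G` = the sign of the block sum). -/
theorem liouville_orthogonal_topDigits_real (ψ : ℕ → ℕ) (hψ' : Tendsto ψ atTop atTop) :
    ∀ ε : ℝ, 0 < ε → ∀ᶠ n : ℕ in atTop, ∀ G : ℕ → ℝ, (∀ u, |G u| ≤ 1) →
      |∑ N ∈ Finset.range (2 ^ n), ((ArithmeticFunction.liouville N : ℤ) : ℝ) *
          G (N / 2 ^ ψ n)| ≤ ε * (2 : ℝ) ^ n := by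
  intro ε hε
  filter_upwards [liouville_orthogonal_topDigits_of_tendsto ψ hψ' ε hε] with n hn G hG
  set a : ℕ → ℝ := fun N => ((ArithmeticFunction.liouville N : ℤ) : ℝ) with ha
  set A : ℕ → ℝ := fun u => ∑ N ∈ (Finset.range (2 ^ n)).filter (fun N => N / 2 ^ ψ n = u), a N
    with hA
  -- the Boolean function realising the sign of the block sums
  set Gb : ℕ → Bool := fun u => decide (A u < 0) with hGb
  have hsgn : ∀ u, sgn (Gb u) * A u = |A u| := by
    intro u
    simp only [hGb, sgn]
    by_cases h : A u < 0
    · rw [decide_eq_true h, if_pos rfl, abs_of_neg h]; ring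
    · rw [decide_eq_false h]; simp [abs_of_nonneg (not_lt.1 h)]
  have h1 : ∑ N ∈ Finset.range (2 ^ n), a N * G (N / 2 ^ ψ n) =
      ∑ u ∈ Finset.range (2 ^ n), G u * A u := sum_range_mul_comp_div n (ψ n) a G
  have h2 : ∑ N ∈ Finset.range (2 ^ n), a N * sgn (Gb (N / 2 ^ ψ n)) =
      ∑ u ∈ Finset.range (2 ^ n), |A u| := by
    rw [sum_range_mul_comp_div n (ψ n) a (fun u => sgn (Gb u))]
    exact Finset.sum_congr rfl fun u _ => hsgn u
  have h3 := hn Gb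
  rw [h2] at h3
  calc |∑ N ∈ Finset.range (2 ^ n), a N * G (N / 2 ^ ψ n)|
      = |∑ u ∈ Finset.range (2 ^ n), G u * A u| := by rw [h1]
    _ ≤ ∑ u ∈ Finset.range (2 ^ n), |G u * A u| := Finset.abs_sum_le_sum_abs _ _
    _ ≤ ∑ u ∈ Finset.range (2 ^ n), |A u| := Finset.sum_le_sum fun u _ => by
        rw [abs_mul]
        exact (mul_le_mul_of_nonneg_right (hG u) (abs_nonneg _)).trans (by rw [one_mul])
    _ ≤ ε * 2 ^ n := le_trans (le_abs_self _) h3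

/-- Digits above position `T` only see `⌊N/2^T⌋`: if `i ≥ T` then
`N.testBit i = (⌊N/2^T⌋ · 2^T).testBit i`. -/
theorem testBit_eq_testBit_div_mul {N T i : ℕ} (hi : T ≤ i) :
    N.testBit i = (N / 2 ^ T * 2 ^ T).testBit i := by
  obtain ⟨j, rfl⟩ := Nat.exists_eq_add_of_le hi
  rw [mul_comm, Nat.testBit_two_pow_mul]
  simp [Nat.testBit_div_two_pow, add_comm]

/-- **The top-digits rung in circuit language (unconditional).** For every unbounded `ψ` and
`ε > 0`, eventually in `n`: every circuit `C` on the `n` binary digits — over ANY gate basis, of any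
depth and size — whose value does not depend on the inputs `x_i`, `i < ψ(n)`, satisfies
`|Σ_{N<2ⁿ} λ(N) sgn C(bits N)| ≤ ε 2ⁿ`. -/
theorem liouville_orthogonal_circuit_topDigits (ψ : ℕ → ℕ) (hψ' : Tendsto ψ atTop atTop) :
    ∀ ε : ℝ, 0 < ε → ∀ᶠ n : ℕ in atTop, ∀ C : Circuit (Fin n),
      (∀ x y : Fin n → Bool, (∀ i : Fin n, ψ n ≤ (i : ℕ) → x i = y i) → C.eval x = C.eval y) →
        |∑ N ∈ Finset.range (2 ^ n), ((ArithmeticFunction.liouville N : ℤ) : ℝ) *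
            sgn (C.eval (fun i : Fin n => Nat.testBit N i))| ≤ ε * (2 : ℝ) ^ n := by
  intro ε hε
  filter_upwards [liouville_orthogonal_topDigits_of_tendsto ψ hψ' ε hε] with n hn C hC
  set G : ℕ → Bool := fun u => C.eval (fun i : Fin n => Nat.testBit (u * 2 ^ ψ n) i) with hG
  have key : ∀ N : ℕ, C.eval (fun i : Fin n => Nat.testBit N i) = G (N / 2 ^ ψ n) := by
    intro N
    exact hC _ _ fun i hi => testBit_eq_testBit_div_mul hi
  simp only [key]
  exact hn G

end Summit.QuantumAdvantage.QuantumAdvantage.Theorems.LiouvilleOrthogonalTC0
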